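import Summits.CriticalPhenomena.PercolationContinuityZ3.Theorems.PercNearOneGluingNoHeavyLowerTailStarSetResidualNoncore
import Summits.CriticalPhenomena.PercolationContinuityZ3.Theorems.PercNearOneGluingNoHeavyLowerTailStarSetResidualCore
import Summits.CriticalPhenomena.PercolationContinuityZ3.Theorems.PercNearOneGluingNoHeavyLowerTailStarSetResidualData
import Summits.CriticalPhenomena.PercolationContinuityZ3.Theorems.PercNearOneGluingNoHeavyLowerTailStarSetResidualLedgerFree
import Summits.CriticalPhenomena.PercolationContinuityZ3.Theorems.PercNearOneGluingNoHeavyLowerTailStarSetResidualLedgerR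
import Summits.CriticalPhenomena.PercolationContinuityZ3.Theorems.PercNearOneGluingNoHeavyLowerTailStarSetPoolAccounting
import HarnessLib

/-!
# `NoHeavyLowerTail` (stmt-CriticalPhenomena-4575) — the RESIDUAL BOUND of the U1′_r charging scheme (U1-PROOF.md §§6–9; blueprint §G4)

Support file (prover `prim-gen-swap` gen 15; `--supports stmt-CriticalPhenomena-4575`).  No definitions, no named facts, no sorries.

`StarSet.residual_bound` is literally the hypothesis `hR` of `StarSet.unit_bound_of_residual` (p220548): the charged units that are in none of
the three early families are paid by the pool credits, the class-words of the class-sets that are neither r-free triangles nor regular triples,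
and `13/128` of the regular-triple words.  Proof: choose the data of every unit (`residual_unit_data`) and a non-inert rider, and a leaf class
`I₀`; sort the units into the eight families; pay the non-core ones by `residual_noncore_bound` and the core ones by `residual_core_bound`
(pool credit `Π_{K ∉ Pool}(1 − θ_K) = Σ_{S ⊆ Pool} W S`, `pool_credit_eq`, and every `S ⊆ Pool` is a credit configuration); then the ledger
`residual_freewords_bound` + `residual_rwords_bound` files every word under an admissible class-set.

* `StarSet.residual_bound`.
-/

namespace Summit.CriticalPhenomena.PercolationContinuityZ3.Theorems

open Finset
open scoped BigOperators Classical

namespace StarSet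

variable {ι V : Type*} [Fintype ι] [LinearOrder ι] [DecidableEq V]

/-- **The residual bound** — the hypothesis `hR` of `StarSet.unit_bound_of_residual`.  See the file header. -/
theorem residual_bound (P P' : ι → V) (hPP' : ∀ X, P X ≠ P' X)
    (hinj : Function.Injective fun X => (s(P X, P' X) : Sym2 V)) (r : V) (F : Finset ι)
    (hforest : ∀ K ∈ F, ∀ I ∈ F, K < I → P' K ≠ P I ∧ P' K ≠ P' I)
    (θ : ι → ℝ) (hθ0 : ∀ X, 0 ≤ θ X) (hθ1 : ∀ X, θ X < 1)
    (O : ι → V → ℝ) (hO0 : ∀ X d, 0 ≤ O X d) (Φ : ι → ℝ)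
    (hO1 : ∀ X d, (P X = d ∨ P' X = d) → θ X ≤ (1 - θ X) * O X d)
    (hO2 : ∀ X, Φ X ^ 2 ≤ O X (P X) * O X (P' X))
    (hΦ4 : ∀ X, 4 * θ X ≤ Φ X) (hΦsq : ∀ X, θ X ≤ Φ X ^ 2)
    (dom : ι → V → ι)
    (hdom : ∀ X ∉ F, ∀ d, (P X = d ∨ P' X = d) →
      dom X d ∈ F ∧ (P (dom X d) = d ∨ P' (dom X d) = d) ∧
        (∀ u, (P (dom X d) = u ∨ P' (dom X d) = u) → (P X = u ∨ P' X = u) → u = d) ∧ θ X ≤ θ (dom X d))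
    (W : Finset ι → ℝ) (hW : ∀ S, W S = (∏ k ∈ S, θ k) * ∏ k ∈ univ \ S, (1 - θ k))
    (C : Finset ι → ℝ) (hC : ∀ T, C T = ∑ δ ∈ (univ : Finset (ι → Bool)).filter (fun δ => (∀ K ∉ T, δ K = false) ∧
        3 ≤ (T.image fun K => if δ K then P K else P' K).card ∧ r ∉ T.image fun K => if δ K then P K else P' K),
      ∏ K ∈ T, O K (if δ K then P K else P' K))
    (Ω : Finset ι → Finset ι) (hΩ : ∀ S, Ω S = S.filter (fun X => X ∈ (univ \ F).filter (fun κ => P κ ≠ r ∧ P' κ ≠ r) ∧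
        ∀ Y ∈ S, (P Y = P X ∨ P Y = P' X ∨ P' Y = P X ∨ P' Y = P' X)))
    (cred : Finset ι → Prop) (hcred : ∀ S, cred S ↔ Ω S = ∅ ∧
      ((∀ I ∈ F, I ∉ S) ∨ ∃ a ∈ F, P a = r ∧ a ∈ S ∧ ∀ b ∈ F, b < a → b ∉ S))
    (free : Finset ι → ι) (hfree : ∀ S, (Ω S).Nonempty → free S ∈ Ω S)
    (hfreeq : ∀ S, (∃ X ∈ Ω S, ∃ I ∈ F, P' I = r ∧ (P X = P I ∨ P' X = P I)) →
      ∃ I ∈ F, P' I = r ∧ (P (free S) = P I ∨ P' (free S) = P I))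
    (TRIS : Finset (Finset ι))
    (hTRIS : ∀ T, T ∈ TRIS ↔ ∃ (a b c : V) (X Y Z : ι), a ≠ b ∧ a ≠ c ∧ b ≠ c ∧ a ≠ r ∧ b ≠ r ∧ c ≠ r ∧
        (s(P X, P' X) : Sym2 V) = s(a, b) ∧ (s(P Y, P' Y) : Sym2 V) = s(a, c) ∧ (s(P Z, P' Z) : Sym2 V) = s(b, c) ∧
        T = {X, Y, Z})
    (REGT : Finset (Finset ι))
    (hREGT : ∀ T, T ∈ REGT ↔ ∃ (M E₁ E₂ : ι) (q₁ q₂ f₁ f₂ : V),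
          M ∉ F ∧ (s(P M, P' M) : Sym2 V) = s(q₁, q₂) ∧ (s(P E₁, P' E₁) : Sym2 V) = s(q₁, f₁) ∧
          (s(P E₂, P' E₂) : Sym2 V) = s(q₂, f₂) ∧ q₁ ≠ q₂ ∧ f₁ ≠ q₁ ∧ f₁ ≠ q₂ ∧ f₂ ≠ q₁ ∧ f₂ ≠ q₂ ∧
          q₁ ≠ r ∧ q₂ ≠ r ∧ f₁ ≠ r ∧ f₂ ≠ r ∧ T = {M, E₁, E₂})
    (U : Finset (Finset ι × ι))
    (hU : ∀ u ∈ U, u.2 ∈ Ω u.1 ∧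
      (((∀ I ∈ F, I ∉ u.1) ∨ ∃ a ∈ F, P a = r ∧ a ∈ u.1 ∧ ∀ b ∈ F, b < a → b ∉ u.1) → u.2 ≠ free u.1) ∧
      ¬ (∃ a b c : V, a ≠ b ∧ a ≠ c ∧ b ≠ c ∧ a ≠ r ∧ b ≠ r ∧ c ≠ r ∧
          (∃ X ∈ u.1, (s(P X, P' X) : Sym2 V) = s(a, b)) ∧ (∃ Y ∈ u.1, (s(P Y, P' Y) : Sym2 V) = s(a, c)) ∧
            ∃ Z ∈ u.1, (s(P Z, P' Z) : Sym2 V) = s(b, c)) ∧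
      ¬ (∃ Y ∈ u.1, Y ≠ u.2 ∧ P Y ≠ r ∧ P' Y ≠ r ∧
          ((∃ p, (P u.2 = p ∨ P' u.2 = p) ∧ P Y ≠ p ∧ P' Y ≠ p ∧ P (dom u.2 p) ≠ r ∧ P' (dom u.2 p) ≠ r) ∨
           (Y ∉ F ∧ ∃ s', (P Y = s' ∨ P' Y = s') ∧ P u.2 ≠ s' ∧ P' u.2 ≠ s' ∧ P (dom Y s') ≠ r ∧ P' (dom Y s') ≠ r))) ∧
      ¬ (∃ d, (P u.2 = d ∨ P' u.2 = d) ∧ P (dom u.2 d) = r ∧ (∃ Y ∈ u.1, P Y ≠ d ∧ P' Y ≠ d) ∧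
          cred (insert (dom u.2 d) (u.1.erase u.2)))) :
    ∑ u ∈ U, W u.1 ≤
      ∑ S ∈ (univ : Finset ι).powerset.filter (fun S => cred S ∧
          ∀ K ∈ S, (K ∉ F ∧ (P K = r ∨ P' K = r)) ∨ (K ∈ F ∧ P K = r)), W S +
        ∑ T ∈ (univ : Finset ι).powerset.filter (fun T => T ∉ TRIS ∧ T ∉ REGT), C T + (13 / 128) * ∑ T ∈ REGT, C T := by
  have hθ1' : ∀ X, θ X ≤ 1 := fun X => (hθ1 X).le
  have hW0 : ∀ S, 0 ≤ W S := fun S => by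
    rw [hW]; exact mul_nonneg (prod_nonneg fun k _ => hθ0 k) (prod_nonneg fun k _ => sub_nonneg.2 (hθ1' k))
  have hC0 : ∀ T, 0 ≤ C T := fun T => by rw [hC]; exact sum_nonneg fun δ _ => prod_nonneg fun K _ => hO0 _ _
  have hdom3 : ∀ X ∉ F, ∀ d, (P X = d ∨ P' X = d) →
      dom X d ∈ F ∧ (P (dom X d) = d ∨ P' (dom X d) = d) ∧
        (∀ u, (P (dom X d) = u ∨ P' (dom X d) = u) → (P X = u ∨ P' X = u) → u = d) :=
    fun X hX d hd => ⟨(hdom X hX d hd).1, (hdom X hX d hd).2.1, (hdom X hX d hd).2.2.1⟩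
  -- no units: nothing to pay
  rcases U.eq_empty_or_nonempty with hU0 | ⟨u₀, hu₀⟩
  · rw [hU0, sum_empty]
    exact add_nonneg (add_nonneg (sum_nonneg fun S _ => hW0 S) (sum_nonneg fun T _ => hC0 T))
      (mul_nonneg (by norm_num) (sum_nonneg fun T _ => hC0 T))
  have hΩmem : ∀ T K, K ∈ Ω T ↔ K ∈ T ∧ (K ∉ F ∧ P K ≠ r ∧ P' K ≠ r) ∧
      ∀ Y ∈ T, (P Y = P K ∨ P Y = P' K ∨ P' Y = P K ∨ P' Y = P' K) := by
    intro T K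
    rw [hΩ T, mem_filter, mem_filter, mem_sdiff]
    simp only [mem_univ, true_and]
  obtain ⟨hX₀Ω, -⟩ := hU u₀ hu₀
  obtain ⟨-, ⟨hXF₀, hXr₀1, hXr₀2⟩, -⟩ := (hΩmem _ _).1 hX₀Ω
  -- the leaf class (or a harmless stand-in)
  obtain ⟨I₀, hleaf, hI₀r, hI₀pool⟩ : ∃ I₀ : ι, (∀ I ∈ F, P' I = r → I = I₀) ∧ (I₀ ∈ F → P' I₀ = r) ∧
      ¬ ((I₀ ∉ F ∧ (P I₀ = r ∨ P' I₀ = r)) ∨ (I₀ ∈ F ∧ P I₀ = r)) := by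
    by_cases h : ∃ I ∈ F, P' I = r
    · obtain ⟨I, hIF, hIr⟩ := h
      refine ⟨I, fun I' hI'F hI'r => leafClass_unique P P' r F hforest hI'F hI'r hIF hIr, fun _ => hIr, ?_⟩
      rintro (⟨hF, -⟩ | ⟨-, hP⟩)
      · exact hF hIF
      · exact hPP' I (hP.trans hIr.symm)
    · refine ⟨u₀.2, fun I hIF hIr => absurd ⟨I, hIF, hIr⟩ h, fun hF => absurd hF hXF₀, ?_⟩
      rintro (⟨-, hr | hr⟩ | ⟨hF, -⟩)
      · exact hXr₀1 hr
      · exact hXr₀2 hr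
      · exact hXF₀ hF
  -- the data of the units
  have hex : ∀ u : Finset ι × ι, ∃ (J : ι) (e ē : V), u ∈ U →
      (u.2 ∈ u.1 ∧ u.2 ∉ F ∧ (P u.2 ≠ r ∧ P' u.2 ≠ r) ∧
      (∀ Y ∈ u.1, P Y = P u.2 ∨ P Y = P' u.2 ∨ P' Y = P u.2 ∨ P' Y = P' u.2) ∧
      ¬ ((∀ I ∈ F, I ∉ u.1) ∨ ∃ a ∈ F, P a = r ∧ a ∈ u.1 ∧ ∀ b ∈ F, b < a → b ∉ u.1) ∧
      J ∈ u.1 ∧ J ∈ F ∧ (∀ I ∈ u.1, I ∈ F → J ≤ I) ∧ P (J) ≠ r ∧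
      ((P u.2 = e ∧ P' u.2 = ē) ∨ (P u.2 = ē ∧ P' u.2 = e)) ∧ (P (J) = e ∨ P' (J) = e) ∧
      ¬ (P (J) = ē ∨ P' (J) = ē) ∧
      ((P (J) = e ∧ P' (J) = r ∧ P (dom u.2 (ē)) ≠ r ∧ P' (dom u.2 (ē)) ≠ r) ∨
       (P (J) ≠ r ∧ P' (J) ≠ r ∧
        ((P (dom u.2 (ē)) = r ∧ P' (dom u.2 (ē)) = ē ∧ J < dom u.2 (ē)) ∨
         (P (dom u.2 (ē)) = ē ∧ P' (dom u.2 (ē)) = r)))) ∧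
      (∀ Y ∈ u.1, Y ≠ u.2 → (P Y ≠ r ∧ P' Y ≠ r) → ∀ p, (P u.2 = p ∨ P' u.2 = p) → (P Y ≠ p ∧ P' Y ≠ p) →
        (P (dom u.2 p) = r ∨ P' (dom u.2 p) = r))) := by
    intro u
    by_cases hu : u ∈ U
    · obtain ⟨hXΩ, hch, hnotri, hnreg, hnadm⟩ := hU u hu
      obtain ⟨J, e, ē, h⟩ := residual_unit_data P P' hPP' hinj r F hforest dom hdom3 Ω hΩ cred hcred free hfree hfreeq
        u.1 u.2 hXΩ hch hnotri hnreg hnadm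
      exact ⟨J, e, ē, fun _ => h⟩
    · exact ⟨u.2, P u.2, P u.2, fun h => absurd h hu⟩
  choose Jf ef ēf hdata using hex
  -- the non-inert riders
  have hexρ : ∀ u : Finset ι × ι, ∃ ρ : ι, (((u.1.erase u.2).erase (Jf u)).filter (fun K => (P K ≠ r ∧ P' K ≠ r) ∧ K ≠ dom u.2 (ēf u))).Nonempty → ρ ∈ (((u.1.erase u.2).erase (Jf u)).filter (fun K => (P K ≠ r ∧ P' K ≠ r) ∧ K ≠ dom u.2 (ēf u))) := by
    intro u
    by_cases h : (((u.1.erase u.2).erase (Jf u)).filter (fun K => (P K ≠ r ∧ P' K ≠ r) ∧ K ≠ dom u.2 (ēf u))).Nonempty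
    · obtain ⟨ρ, hρ⟩ := h; exact ⟨ρ, fun _ => hρ⟩
    · exact ⟨u.2, fun h' => absurd h' h⟩
  choose ρf hρ' using hexρ
  have hρ : ∀ u ∈ U, (((u.1.erase u.2).erase (Jf u)).filter (fun K => (P K ≠ r ∧ P' K ≠ r) ∧ K ≠ dom u.2 (ēf u))).Nonempty → ρf u ∈ (((u.1.erase u.2).erase (Jf u)).filter (fun K => (P K ≠ r ∧ P' K ≠ r) ∧ K ≠ dom u.2 (ēf u))) := fun u _ => hρ' u
  -- (1) every unit is in one of the eight families
  have key8 : ∀ (w : ℝ) (a b c d e f g h : Prop) (da : Decidable a) (db : Decidable b) (dc : Decidable c) (dd : Decidable d)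
      (de : Decidable e) (df : Decidable f) (dg : Decidable g) (dh : Decidable h), 0 ≤ w → (a ∨ b ∨ c ∨ d ∨ e ∨ f ∨ g ∨ h) →
      w ≤ @ite ℝ a da w 0 + @ite ℝ b db w 0 + @ite ℝ c dc w 0 + @ite ℝ d dd w 0 + @ite ℝ e de w 0 +
        (@ite ℝ f df w 0 + @ite ℝ g dg w 0 + @ite ℝ h dh w 0) := by
    intro w a b c d e f g h da db dc dd de df dg dh hw hor
    have n : ∀ (p : Prop) (dp : Decidable p), 0 ≤ @ite ℝ p dp w 0 := fun p dp => by split_ifs <;> linarith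
    rcases hor with hp | hp | hp | hp | hp | hp | hp | hp <;> rw [if_pos hp] <;>
      linarith [n a da, n b db, n c dc, n d dd, n e de, n f df, n g dg, n h dh]
  have hcover : ∑ u ∈ U, W u.1 ≤
      ∑ u ∈ U.filter (fun u => (¬ (P (Jf u) = ef u ∧ P' (Jf u) = r) ∧ dom u.2 (ef u) ≠ Jf u ∧ (P (dom u.2 (ef u)) ≠ r ∧ P' (dom u.2 (ef u)) ≠ r))), W u.1 +
      ∑ u ∈ U.filter (fun u => (P (Jf u) = ef u ∧ P' (Jf u) = r) ∧ (((u.1.erase u.2).erase (Jf u)).filter (fun K => (P K ≠ r ∧ P' K ≠ r) ∧ K ≠ dom u.2 (ēf u))).Nonempty), W u.1 +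
      ∑ u ∈ U.filter (fun u => ¬ (P (Jf u) = ef u ∧ P' (Jf u) = r) ∧ ¬ (¬ (P (Jf u) = ef u ∧ P' (Jf u) = r) ∧ dom u.2 (ef u) ≠ Jf u ∧ (P (dom u.2 (ef u)) ≠ r ∧ P' (dom u.2 (ef u)) ≠ r)) ∧ (((u.1.erase u.2).erase (Jf u)).filter (fun K => (P K ≠ r ∧ P' K ≠ r) ∧ K ≠ dom u.2 (ēf u))).Nonempty ∧ (P (ρf u) = ef u ∨ P' (ρf u) = ef u) ∧ ρf u ∈ F), W u.1 +
      ∑ u ∈ U.filter (fun u => ¬ (P (Jf u) = ef u ∧ P' (Jf u) = r) ∧ ¬ (¬ (P (Jf u) = ef u ∧ P' (Jf u) = r) ∧ dom u.2 (ef u) ≠ Jf u ∧ (P (dom u.2 (ef u)) ≠ r ∧ P' (dom u.2 (ef u)) ≠ r)) ∧ (((u.1.erase u.2).erase (Jf u)).filter (fun K => (P K ≠ r ∧ P' K ≠ r) ∧ K ≠ dom u.2 (ēf u))).Nonempty ∧ (P (ρf u) = ef u ∨ P' (ρf u) = ef u) ∧ ρf u ∉ F), W u.1 +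
      ∑ u ∈ U.filter (fun u => ¬ (P (Jf u) = ef u ∧ P' (Jf u) = r) ∧ ¬ (¬ (P (Jf u) = ef u ∧ P' (Jf u) = r) ∧ dom u.2 (ef u) ≠ Jf u ∧ (P (dom u.2 (ef u)) ≠ r ∧ P' (dom u.2 (ef u)) ≠ r)) ∧ (((u.1.erase u.2).erase (Jf u)).filter (fun K => (P K ≠ r ∧ P' K ≠ r) ∧ K ≠ dom u.2 (ēf u))).Nonempty ∧ ¬ (P (ρf u) = ef u ∨ P' (ρf u) = ef u)), W u.1 +
      (∑ u ∈ U.filter (fun u => ¬ (P (Jf u) = ef u ∧ P' (Jf u) = r) ∧ ¬ (¬ (P (Jf u) = ef u ∧ P' (Jf u) = r) ∧ dom u.2 (ef u) ≠ Jf u ∧ (P (dom u.2 (ef u)) ≠ r ∧ P' (dom u.2 (ef u)) ≠ r)) ∧ ¬ (((u.1.erase u.2).erase (Jf u)).filter (fun K => (P K ≠ r ∧ P' K ≠ r) ∧ K ≠ dom u.2 (ēf u))).Nonempty ∧ ¬ (P' (dom u.2 (ēf u)) = r ∧ Jf u = dom u.2 (ef u))), W u.1 +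
       ∑ u ∈ U.filter (fun u => (P (Jf u) = ef u ∧ P' (Jf u) = r) ∧ ¬ (((u.1.erase u.2).erase (Jf u)).filter (fun K => (P K ≠ r ∧ P' K ≠ r) ∧ K ≠ dom u.2 (ēf u))).Nonempty ∧ dom u.2 (ef u) ≠ Jf u), W u.1 +
       ∑ u ∈ U.filter (fun u => ¬ (((u.1.erase u.2).erase (Jf u)).filter (fun K => (P K ≠ r ∧ P' K ≠ r) ∧ K ≠ dom u.2 (ēf u))).Nonempty ∧ (((P (Jf u) = ef u ∧ P' (Jf u) = r) ∧ dom u.2 (ef u) = Jf u) ∨ (¬ (P (Jf u) = ef u ∧ P' (Jf u) = r) ∧ ¬ (¬ (P (Jf u) = ef u ∧ P' (Jf u) = r) ∧ dom u.2 (ef u) ≠ Jf u ∧ (P (dom u.2 (ef u)) ≠ r ∧ P' (dom u.2 (ef u)) ≠ r)) ∧ (P' (dom u.2 (ēf u)) = r ∧ Jf u = dom u.2 (ef u))))), W u.1) := by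
    rw [sum_filter, sum_filter, sum_filter, sum_filter, sum_filter, sum_filter, sum_filter, sum_filter,
      ← sum_add_distrib, ← sum_add_distrib, ← sum_add_distrib, ← sum_add_distrib, ← sum_add_distrib, ← sum_add_distrib,
      ← sum_add_distrib]
    refine sum_le_sum fun u hu => key8 _ _ _ _ _ _ _ _ _ _ _ _ _ _ _ _ _ (hW0 u.1) ?_
    by_cases hb : (¬ (P (Jf u) = ef u ∧ P' (Jf u) = r) ∧ dom u.2 (ef u) ≠ Jf u ∧ (P (dom u.2 (ef u)) ≠ r ∧ P' (dom u.2 (ef u)) ≠ r))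
    · exact Or.inl hb
    by_cases h1 : (P (Jf u) = ef u ∧ P' (Jf u) = r)
    · by_cases hh : (((u.1.erase u.2).erase (Jf u)).filter (fun K => (P K ≠ r ∧ P' K ≠ r) ∧ K ≠ dom u.2 (ēf u))).Nonempty
      · exact Or.inr (Or.inl ⟨h1, hh⟩)
      · by_cases hD : dom u.2 (ef u) = Jf u
        · exact Or.inr (Or.inr (Or.inr (Or.inr (Or.inr (Or.inr (Or.inr ⟨hh, Or.inl ⟨h1, hD⟩⟩))))))
        · exact Or.inr (Or.inr (Or.inr (Or.inr (Or.inr (Or.inr (Or.inl ⟨h1, hh, hD⟩))))))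
    · by_cases hh : (((u.1.erase u.2).erase (Jf u)).filter (fun K => (P K ≠ r ∧ P' K ≠ r) ∧ K ≠ dom u.2 (ēf u))).Nonempty
      · by_cases hr : (P (ρf u) = ef u ∨ P' (ρf u) = ef u)
        · by_cases hF : ρf u ∈ F
          · exact Or.inr (Or.inr (Or.inl ⟨h1, hb, hh, hr, hF⟩))
          · exact Or.inr (Or.inr (Or.inr (Or.inl ⟨h1, hb, hh, hr, hF⟩)))
        · exact Or.inr (Or.inr (Or.inr (Or.inr (Or.inl ⟨h1, hb, hh, hr⟩))))
      · by_cases hn : (P' (dom u.2 (ēf u)) = r ∧ Jf u = dom u.2 (ef u))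
        · exact Or.inr (Or.inr (Or.inr (Or.inr (Or.inr (Or.inr (Or.inr ⟨hh, Or.inr ⟨h1, hb, hn⟩⟩))))))
        · exact Or.inr (Or.inr (Or.inr (Or.inr (Or.inr (Or.inl ⟨h1, hb, hh, hn⟩)))))
  -- (2) the pool credit is a sum of credit configurations
  have hpool : ∏ k ∈ univ \ (univ : Finset ι).filter (fun K => (K ∉ F ∧ (P K = r ∨ P' K = r)) ∨ (K ∈ F ∧ P K = r)), (1 - θ k) ≤
      ∑ S ∈ (univ : Finset ι).powerset.filter (fun S => cred S ∧
          ∀ K ∈ S, (K ∉ F ∧ (P K = r ∨ P' K = r)) ∨ (K ∈ F ∧ P K = r)), W S := by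
    rw [← pool_credit_eq θ ((univ : Finset ι).filter (fun K => (K ∉ F ∧ (P K = r ∨ P' K = r)) ∨ (K ∈ F ∧ P K = r)))]
    simp only [mul_boole]
    rw [← sum_filter]
    simp only [← hW]
    refine sum_le_sum_of_subset_of_nonneg (fun S hS => ?_) (fun S _ _ => hW0 S)
    obtain ⟨hS, hsub⟩ := mem_filter.1 hS
    have hpoolK : ∀ K ∈ S, (K ∉ F ∧ (P K = r ∨ P' K = r)) ∨ (K ∈ F ∧ P K = r) := fun K hK => (mem_filter.1 (hsub hK)).2
    refine mem_filter.2 ⟨hS, (hcred S).2 ⟨?_, ?_⟩, hpoolK⟩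
    · refine eq_empty_of_forall_notMem fun K hK => ?_
      obtain ⟨hKS, ⟨hKF, hKr1, hKr2⟩, -⟩ := (hΩmem S K).1 hK
      rcases hpoolK K hKS with ⟨-, h | h⟩ | ⟨hF, -⟩
      · exact hKr1 h
      · exact hKr2 h
      · exact hKF hF
    · by_cases hSF : (S.filter (· ∈ F)).Nonempty
      · right
        have ha := min'_mem _ hSF
        obtain ⟨haS, haF⟩ := mem_filter.1 ha
        refine ⟨(S.filter (· ∈ F)).min' hSF, haF, ?_, haS, fun b hbF hlt hbS => ?_⟩
        · rcases hpoolK _ haS with ⟨hF, -⟩ | ⟨-, hP⟩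
          · exact absurd haF hF
          · exact hP
        · exact absurd (min'_le _ b (mem_filter.2 ⟨hbS, hbF⟩)) (not_le.2 hlt)
      · left
        intro I hIF hIS
        exact hSF ⟨I, mem_filter.2 ⟨hIS, hIF⟩⟩
  -- (3) the families and the ledger
  have h1 := residual_noncore_bound P P' hPP' hinj r F θ hθ0 hθ1 O hO0 Φ hO1 hO2 hΦ4 hΦsq dom hdom I₀ hleaf U Jf ef ēf ρf hdata hρ
  have h2 := residual_core_bound P P' hPP' hinj r F θ hθ0 hθ1 O hO0 hO1 dom hdom I₀ hI₀pool hleaf hI₀r U Jf ef ēf hdata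
    _ _ _ rfl rfl rfl
  have h4 := residual_freewords_bound P P' hPP' hinj r F dom hdom3 I₀ hleaf hI₀r U Jf ef ēf ρf hdata hρ _ _ _ _ _
    rfl rfl rfl rfl rfl TRIS REGT hTRIS hREGT C
    (fun T => (∑ δ ∈ ((univ : Finset (ι → Bool)).filter (fun δ => (∀ K ∉ T, δ K = false) ∧
            3 ≤ (T.image fun K => if δ K then P K else P' K).card ∧ r ∉ T.image fun K => if δ K then P K else P' K)).filter
            (fun δ => ∀ K ∈ T, K ∉ F → ∀ I ∈ T, I ∈ F → (if δ K then P K else P' K) ≠ P I ∧ (if δ K then P K else P' K) ≠ P' I),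
          ∏ K ∈ T, O K (if δ K then P K else P' K)))
    (fun T => (∑ δ ∈ ((univ : Finset (ι → Bool)).filter (fun δ => (∀ K ∉ T, δ K = false) ∧
            3 ≤ (T.image fun K => if δ K then P K else P' K).card ∧ r ∉ T.image fun K => if δ K then P K else P' K)).filter
            (fun δ => ¬ ∀ K ∈ T, K ∉ F → ∀ I ∈ T, I ∈ F →
              (if δ K then P K else P' K) ≠ P I ∧ (if δ K then P K else P' K) ≠ P' I),
          ∏ K ∈ T, O K (if δ K then P K else P' K)))
    hC0 (fun T => sum_nonneg fun δ _ => prod_nonneg fun K _ => hO0 _ _)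
    (fun T => sum_nonneg fun δ _ => prod_nonneg fun K _ => hO0 _ _)
    (fun T => by rw [hC]; exact sum_filter_add_sum_filter_not _ _ _)
  have h5 := residual_rwords_bound P P' hPP' hinj r F dom hdom3 I₀ hleaf hI₀r U Jf ef ēf ρf hdata hρ _ _ _ _ rfl rfl rfl rfl
    TRIS REGT hTRIS hREGT C hC0
  have hsplit : ∑ T ∈ ((univ : Finset ι).powerset.filter (fun T => T ∉ TRIS ∧ T ∉ REGT)).filter
        (fun T => ∃ K ∈ T, P K = r ∨ P' K = r), C T +
      ∑ T ∈ ((univ : Finset ι).powerset.filter (fun T => T ∉ TRIS ∧ T ∉ REGT)).filter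
        (fun T => ¬ ∃ K ∈ T, P K = r ∨ P' K = r), C T =
      ∑ T ∈ ((univ : Finset ι).powerset.filter (fun T => T ∉ TRIS ∧ T ∉ REGT)), C T := sum_filter_add_sum_filter_not _ _ _
  simp only [← hW, ← hC] at h1 h2
  linarith [hcover, h1, h2, hpool, h4, h5, hsplit]

end StarSet

end Summit.CriticalPhenomena.PercolationContinuityZ3.Theorems
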